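import Mathlib
import HarnessLib

/-!
# Route `ExtremiserTransience`, LINE g5-α repair (seat ns-idea-5 g5): mass of a constant-speed slice in a ball

`--supports stmt-NavierStokesRegularity-27823` (`PlateauSliceRigidity`).  Stub 3 `stub_ballMassLower` of the skeleton `PlateauSliceRigidity_birth.lean`
(evidence on 27823), proved: a slice of constant speed `m > 0` has `∫_{B(0,ρ)} ‖W t₀‖² = m²·|B₁|·ρ³`, in particular `≥ c ρ³` for `ρ ≥ 1`.  Together with
`sliceConstantSpeed` (stub 1, p635764) this leaves item 27823 EXACTLY at its stub 2, the LOCAL ENERGY BUDGET `∫_{B(0,ρ)} ‖W(t₀)‖² ≤ C(K,t₀) ρ²` of a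
continuous Oseen-mild Type-I-decaying ancient field.  HONEST FRAMING: elementary; nothing about Navier–Stokes is proved and no summit is proved by a line.
[folklore]
-/

namespace Summit.NavierStokesRegularity.NavierStokesRegularity.Theorems.ExtremiserTransience
set_option linter.dupNamespace false

open Set MeasureTheory

/-- **Stub 3 of the 27823 skeleton, proved** (statement verbatim from `PlateauSliceRigidity_birth.lean`). [folklore] -/
theorem ballMassLower (W : ℝ → EuclideanSpace ℝ (Fin 3) → EuclideanSpace ℝ (Fin 3)) (t₀ m : ℝ) (hm : 0 < m)
    (hconst : ∀ y, ‖W t₀ y‖ = m) :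
    ∃ c : ℝ, 0 < c ∧ ∀ ρ : ℝ, 1 ≤ ρ → c * ρ ^ 3 ≤ ∫ y in Metric.ball (0 : EuclideanSpace ℝ (Fin 3)) ρ, ‖W t₀ y‖ ^ 2 := by
  set V : ℝ := (volume (Metric.ball (0 : EuclideanSpace ℝ (Fin 3)) 1)).toReal with hV
  have hVpos : 0 < V :=
    ENNReal.toReal_pos (Metric.measure_ball_pos volume (0 : EuclideanSpace ℝ (Fin 3)) one_pos).ne' measure_ball_lt_top.ne
  refine ⟨m ^ 2 * V, by positivity, fun ρ hρ => ?_⟩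
  have hρ0 : 0 < ρ := by linarith
  have hint : ∫ y in Metric.ball (0 : EuclideanSpace ℝ (Fin 3)) ρ, ‖W t₀ y‖ ^ 2
      = (volume (Metric.ball (0 : EuclideanSpace ℝ (Fin 3)) ρ)).toReal * m ^ 2 := by
    simp_rw [hconst]
    rw [setIntegral_const, smul_eq_mul]
    rfl
  have hball : volume (Metric.ball (0 : EuclideanSpace ℝ (Fin 3)) ρ)
      = ENNReal.ofReal (ρ ^ 3) * volume (Metric.ball (0 : EuclideanSpace ℝ (Fin 3)) 1) := by
    rw [Measure.addHaar_ball_of_pos volume (0 : EuclideanSpace ℝ (Fin 3)) hρ0]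
    simp [finrank_euclideanSpace]
  rw [hint, hball, ENNReal.toReal_mul, ENNReal.toReal_ofReal (by positivity)]
  exact le_of_eq (by rw [hV]; ring)

end Summit.NavierStokesRegularity.NavierStokesRegularity.Theorems.ExtremiserTransience
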